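import Summits.Ventures.PercRepro.CoreCountB
import Summits.Ventures.PercRepro.CoreRegimesFive
import Summits.Ventures.PercRepro.TheoremNAll

/-!
# PercRepro — C-025 at `(p, 3)` on the large-corank core: every `p ≥ 13` with corank `d ≥ 6` (every `p ≥ 9` with `d ≥ amin p`), every `p ≥ 201` with `d ≥ 5` (p2, gen 11)

The assembly of night-1's counting route to C-025 at `q = 3` (`proofs/NIGHT-1-C025-induction.md` §12–§13, THEOREM E)
on the core of the wrapper `rls_succ_all`: a simple matroid of rank `p` on `n = p + d` points in which (C1) every
rank-`2` set has `≤ 3` points and (C2) every rank-`3` set has `≤ 7` points. The counts of `CoreCountA` / `CoreCountB`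
give `#U(p,3) ≤ W₃ ≤ (2 + ρ)·C(n,3)`, `#{r ≤ 3} ≤ Σ_{j≤3} C(n,j) + (1 + ρ)·C(n,3)`, `#{spanning} ≤ Σ_{j≤d} C(n,j)`
(night-1's `ncard_spanning_le`), `#Y ≥ 2ⁿ − #{r ≤ 3} − #{spanning}` and `#Y ≥ Σ_{u=4}^{p−1} C(n,u) − #{r ≤ 3}`;
THEOREM R3 in its kernel range (`CoreRegimes.regime_of_le`: `9 ≤ p ≤ 62` by the kernel-evaluated cells of
`CoreRegimesTable`, `p ≥ 63, d ≥ 6` by `CoreRegimesLow`, `p ≥ 201, d ≥ 5` by `CoreRegimesFive`) supplies regime A or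
regime B′ of the arithmetic — and either one closes `Φ(p,3)·#U ≤ #Y`; `c025_core_of_regime_aux` takes the regime
disjunction itself as its hypothesis.

* **`c025_core_of_regime_aux`** — `ThmN.RLS M p 3` (the body of `C025` at `(p, 3)`) for every finite simple matroid with
  `r(E) = p`, `|E| = p + d`, (C1), (C2), given `RegimeA p d ∨ RegimeB p d`; its faces **`c025_core_of_regime`**
  (`p ≥ 13`, `d ≥ 6`), **`c025_core_of_amin`** (`p ≥ 9`, `d ≥ amin p`) and **`c025_core_of_regime_five`** (`p ≥ 201`, `d ≥ 5`).
  The hypotheses (C1), (C2) are exactly the conclusions of night-1's `RankLevelSetCoreSparse` on the core of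
  `rls_succ_all` (night-1's wrapper needs the core at EVERY `(p, d)`, so these are core cells, not an all-matroid
  statement); the remaining core residue is the small corank (`d ≤ 5`, resp. `d ≤ 4` at `p ≥ 201` — night-1's regime C)
  and `p ≤ 8` (where `q + 2 ≤ p` leaves `(5,3)`–`(8,3)`, the cell's separate theorems).
Imports `CoreCountB`, `CoreRegimesFive`, `TheoremNAll` (for `ThmN.RLS`). Axioms: standard.
-/

namespace PercRepro
namespace CoreCount

open Finset ThmH

variable {α : Type} {M : Matroid α} [M.Finite]

/-- **C-025 at `(p, 3)` on the large-corank core, given the regime**: a simple matroid of rank `p` on `p + d` points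
with (C1) and (C2) satisfies `Φ(p,3)·#U(p,3) ≤ #Y(p,3)` whenever regime A or regime B′ holds at `(p, d)`. -/
theorem c025_core_of_regime_aux (M : Matroid α) [M.Finite] (p d : ℕ) (hreg : CoreRegimes.RegimeA p d ∨ CoreRegimes.RegimeB p d)
    (hs : ∀ e ∈ M.E, ∀ f ∈ M.E, e ≠ f → M.eRk {e, f} = 2)
    (hC1 : ∀ L ⊆ M.E, M.eRk L = 2 → L.ncard ≤ 3) (hC2 : ∀ P ⊆ M.E, M.eRk P = 3 → P.ncard ≤ 7)
    (hrank : M.eRank = (p : ℕ∞)) (hE : M.E.ncard = p + d) : ThmN.RLS M p 3 := by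
  classical
  unfold ThmN.RLS
  have hs' : Simple M := hs
  have hC1f : ∀ L ⊆ gr M, M.eRk (L : Set α) = 2 → L.card ≤ 3 := by
    intro L hL hr
    have hLE : (L : Set α) ⊆ M.E := by rw [← coe_gr M]; exact_mod_cast hL
    have := hC1 (L : Set α) hLE hr
    rwa [Set.ncard_coe_finset] at this
  have hC2f : ∀ P ⊆ gr M, M.eRk (P : Set α) = 3 → P.card ≤ 7 := by
    intro P hP hr
    have hPE : (P : Set α) ⊆ M.E := by rw [← coe_gr M]; exact_mod_cast hP
    have := hC2 (P : Set α) hPE hr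
    rwa [Set.ncard_coe_finset] at this
  -- `n = |E| = p + d`
  have hn : (gr M).card = p + d := by
    rw [← hE]
    unfold gr
    rw [← Set.ncard_eq_toFinset_card M.E M.ground_finite]
  have hgr : M.ground_finite.toFinset.card = p + d := hn
  have hd' : M.E.encard = M.eRank + d := by
    rw [hrank, ← M.ground_finite.cast_ncard_eq, hE]
    push_cast
    rfl
  -- the counts
  have hU := ncard_U_le_card_rank3Sets M p
  have hW := thirtyfive_mul_card_rank3Sets_le hs' hC1f hC2f
  have hR := ncard_rankLe3_eq M
  have hR' := thirtyfive_mul_card_rankLe3_le hs' hC1f hC2f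
  have hSp := Matroid.ncard_spanning_le (M := M) hd'
  have hYA := two_pow_le_ncard_Y_add M p hrank
  have hYB := sum_choose_le_ncard_Y_add M p
  rw [hn] at hW hR' hYA hYB
  rw [hgr] at hSp
  rw [hR] at hYA hYB
  have hphi := CoreRegimes.phiK_three_nonneg p
  -- everything in `ℚ`
  have hUq : (({A : Set α | A ⊆ M.E ∧ M.eRk A = (p : ℕ∞) ∧ M.eRk (M.E \ A) = ((3 : ℕ) : ℕ∞)}.ncard : ℕ) : ℚ)
      ≤ ((rank3Sets M).card : ℚ) := by exact_mod_cast hU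
  have hWq : 35 * ((rank3Sets M).card : ℚ) ≤ 134 * (Nat.choose (p + d) 3 : ℚ) := by exact_mod_cast hW
  have hRq : 35 * (((rankLe3 M).card : ℕ) : ℚ)
      ≤ 35 * (∑ j ∈ range 4, (Nat.choose (p + d) j : ℚ)) + 99 * (Nat.choose (p + d) 3 : ℚ) := by
    exact_mod_cast hR'
  have hSpq : (({X : Set α | X ⊆ M.E ∧ M.eRk X = M.eRank}.ncard : ℕ) : ℚ)
      ≤ ∑ j ∈ range (d + 1), (Nat.choose (p + d) j : ℚ) := by exact_mod_cast hSp
  have hYAq : (2 : ℚ) ^ (p + d)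
      ≤ (({A : Set α | A ⊆ M.E ∧ ((3 : ℕ) : ℕ∞) < M.eRk A ∧ M.eRk A < (p : ℕ∞)}.ncard : ℕ) : ℚ)
        + (((rankLe3 M).card : ℕ) : ℚ)
        + (({X : Set α | X ⊆ M.E ∧ M.eRk X = M.eRank}.ncard : ℕ) : ℚ) := by exact_mod_cast hYA
  have hYBq : (∑ u ∈ Ico 4 p, (Nat.choose (p + d) u : ℚ))
      ≤ (({A : Set α | A ⊆ M.E ∧ ((3 : ℕ) : ℕ∞) < M.eRk A ∧ M.eRk A < (p : ℕ∞)}.ncard : ℕ) : ℚ)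
        + (((rankLe3 M).card : ℕ) : ℚ) := by exact_mod_cast hYB
  -- `Φ·#U ≤ Φ·U(n)`
  set U : ℚ := (({A : Set α | A ⊆ M.E ∧ M.eRk A = (p : ℕ∞) ∧ M.eRk (M.E \ A) = ((3 : ℕ) : ℕ∞)}.ncard : ℕ) : ℚ) with hU_def
  set Y : ℚ := (({A : Set α | A ⊆ M.E ∧ ((3 : ℕ) : ℕ∞) < M.eRk A ∧ M.eRk A < (p : ℕ∞)}.ncard : ℕ) : ℚ) with hY_def
  set R : ℚ := (((rankLe3 M).card : ℕ) : ℚ) with hR_def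
  set Sp : ℚ := (({X : Set α | X ⊆ M.E ∧ M.eRk X = M.eRank}.ncard : ℕ) : ℚ) with hSp_def
  set W : ℚ := ((rank3Sets M).card : ℚ) with hW_def
  set C3 : ℚ := (Nat.choose (p + d) 3 : ℚ) with hC3_def
  set S4 : ℚ := ∑ j ∈ range 4, (Nat.choose (p + d) j : ℚ) with hS4_def
  set Sd : ℚ := ∑ j ∈ range (d + 1), (Nat.choose (p + d) j : ℚ) with hSd_def
  set Tp : ℚ := ∑ u ∈ Ico 4 p, (Nat.choose (p + d) u : ℚ) with hTp_def
  set nq : ℚ := ((p + d : ℕ) : ℚ) with hnq_def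
  have hU1 : U ≤ (134 / 35) * C3 := by linarith [hUq, hWq]
  have hR1 : R ≤ S4 + (99 / 35) * C3 := by linarith [hRq]
  have hsq : (0 : ℚ) ≤ nq ^ 2 := sq_nonneg _
  have hPU : phiK p 3 * U ≤ phiK p 3 * ((2 + 64 / 35) * C3 + nq ^ 2) := by
    apply mul_le_mul_of_nonneg_left _ hphi
    linarith [hU1, hsq]
  rcases hreg with hA | hB
  · unfold CoreRegimes.RegimeA CoreRegimes.lhsU CoreRegimes.Ubound CoreRegimes.Rbound CoreRegimes.rhoCore at hA
    have hA' : phiK p 3 * ((2 + 64 / 35) * C3 + nq ^ 2) + (S4 + (1 + 64 / 35) * C3 + nq ^ 2) + Sd ≤ (2 : ℚ) ^ (p + d) := hA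
    have hYA' : (2 : ℚ) ^ (p + d) ≤ Y + R + Sp := hYAq
    have hSp' : Sp ≤ Sd := hSpq
    show phiK p 3 * U ≤ Y
    linarith [hPU, hA', hR1, hSp', hYA', hsq]
  · unfold CoreRegimes.RegimeB CoreRegimes.lhsU CoreRegimes.Ubound CoreRegimes.Rbound CoreRegimes.rhoCore at hB
    have hB' : phiK p 3 * ((2 + 64 / 35) * C3 + nq ^ 2) + (S4 + (1 + 64 / 35) * C3 + nq ^ 2) ≤ Tp := hB
    have hYB' : Tp ≤ Y + R := hYBq
    show phiK p 3 * U ≤ Y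
    linarith [hPU, hB', hR1, hYB', hsq]


/-- **C-025 at `(p, 3)` on the core for every `p ≥ 13` and every corank `d ≥ 6`.** -/
theorem c025_core_of_regime (M : Matroid α) [M.Finite] (p d : ℕ) (hp : 13 ≤ p) (hd : 6 ≤ d)
    (hs : ∀ e ∈ M.E, ∀ f ∈ M.E, e ≠ f → M.eRk {e, f} = 2)
    (hC1 : ∀ L ⊆ M.E, M.eRk L = 2 → L.ncard ≤ 3) (hC2 : ∀ P ⊆ M.E, M.eRk P = 3 → P.ncard ≤ 7)
    (hrank : M.eRank = (p : ℕ∞)) (hE : M.E.ncard = p + d) : ThmN.RLS M p 3 :=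
  c025_core_of_regime_aux M p d (CoreRegimes.regime_of_six_le_all p d hp hd) hs hC1 hC2 hrank hE

/-- **C-025 at `(p, 3)` on the core for every `p ≥ 9` and every corank `d ≥ amin p`** (`amin = 8, 7, 7, 7, 6, 6, …`). -/
theorem c025_core_of_amin (M : Matroid α) [M.Finite] (p d : ℕ) (hp : 9 ≤ p) (hd : CoreRegimes.amin p ≤ d)
    (hs : ∀ e ∈ M.E, ∀ f ∈ M.E, e ≠ f → M.eRk {e, f} = 2)
    (hC1 : ∀ L ⊆ M.E, M.eRk L = 2 → L.ncard ≤ 3) (hC2 : ∀ P ⊆ M.E, M.eRk P = 3 → P.ncard ≤ 7)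
    (hrank : M.eRank = (p : ℕ∞)) (hE : M.E.ncard = p + d) : ThmN.RLS M p 3 :=
  c025_core_of_regime_aux M p d (CoreRegimes.regime_of_amin p d hp hd) hs hC1 hC2 hrank hE

/-- **C-025 at `(p, 3)` on the core for every `p ≥ 201` and every corank `d ≥ 5`.** -/
theorem c025_core_of_regime_five (M : Matroid α) [M.Finite] (p d : ℕ) (hp : 201 ≤ p) (hd : 5 ≤ d)
    (hs : ∀ e ∈ M.E, ∀ f ∈ M.E, e ≠ f → M.eRk {e, f} = 2)
    (hC1 : ∀ L ⊆ M.E, M.eRk L = 2 → L.ncard ≤ 3) (hC2 : ∀ P ⊆ M.E, M.eRk P = 3 → P.ncard ≤ 7)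
    (hrank : M.eRank = (p : ℕ∞)) (hE : M.E.ncard = p + d) : ThmN.RLS M p 3 :=
  c025_core_of_regime_aux M p d (CoreRegimes.regime_of_five_le p d hp hd) hs hC1 hC2 hrank hE

end CoreCount
end PercRepro
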